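import Summits.SmoothPoincare4.SmoothPoincare4.Theorems.RootDecompAEDoublesShadowTwoRoeBlockSeg

/-!
# Grade-two dichotomy for KMN encoding graphs (Roe certificates), part 17/17: the assembly, II, and the registered stub

§12b `blocks_seg` (the blocks of a structural certificate in order) and §13 `theorem stub_gradeTwoDichotomy :
GradeTwoDichotomy` — one-letter relators first, then the pieces in peeling order.

THE FAMILY (16 modules `Theorems/RootDecompAEDoublesShadowTwoRoe*.lean` + the closing module
`Theorems/RootDecompAEDoublesShadowTwoStubGradeTwoDichotomy.lean`, one namespace
`Summit.SmoothPoincare4.SmoothPoincare4.Theorems.RootDecompAEDoublesShadowTwoStubGradeTwoDichotomy`, chained imports,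
split by topic to respect the 400-line bound on proof files; the local-table parts import only `…RoeDefs`).
-/

open Function
open Literature.Topology.FourManifolds

set_option linter.dupNamespace false

noncomputable section

namespace Summit.SmoothPoincare4.SmoothPoincare4.Theorems.RootDecompAEDoublesShadowTwoStubGradeTwoDichotomy

namespace ShadowGraph

variable {G₂ : ShadowGraph}

/-- **THE BLOCKS.**  The blocks of a structural certificate, processed in order, form a valid segment from any
killing state whose eliminated letters are exactly the stable letters, the unused letters and the letters of the
pieces `Done` eliminated before, and whose used relators are the one-letter relators and the relators of rows
`Used` disjoint from the owned rows; it ends in the corresponding state for `Done ∪ pieces(bs)` and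
`Used ∪ owned rows`. -/
theorem blocks_seg (hself : ∀ e, (G₂.src e).1 ≠ (G₂.tgt e).1) (hI : G₂.PortsInjective) {n : ℕ} (eg : G₂.Gen ≃ Fin n)
    (er : G₂.Rel ≃ Fin n) :
    ∀ (bs : List (Fin G₂.k × Finset (Fin G₂.m))) (Done : Finset (Fin G₂.k)) (Used : Fin G₂.m → Prop) (st : Roe.State n),
      G₂.BlocksOK Done bs → (bs.map Prod.fst).Nodup → (∀ b ∈ bs, b.1 ∉ Done) →
      bs.Pairwise (fun b b' => Disjoint b.2 b'.2) → (∀ b ∈ bs, ∀ e ∈ b.2, ¬ Used e) →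
      Roe.Kills st.1 st.2.1 →
      (∀ y, y ∈ st.2.1 ↔ (∃ e, y = eg (Sum.inr e)) ∨
        (∃ p : Fin G₂.k × Fin 3, (G₂.piece p.1).rank ≤ (p.2 : ℕ) ∧ y = eg (Sum.inl p)) ∨
          ∃ w ∈ Done, ∃ i, y = eg (Sum.inl (w, i))) →
      (∀ r, r ∈ st.2.2 ↔ (∃ x, r = er (Sum.inr x)) ∨ ∃ e, Used e ∧ r = er (Sum.inl e)) →
      ∃ seg : List (Roe.Step n), Roe.SegValid (G₂.presentation eg er) seg st ∧
        Roe.Kills (Roe.endState seg st).1 (Roe.endState seg st).2.1 ∧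
        (∀ y, y ∈ (Roe.endState seg st).2.1 ↔ (∃ e, y = eg (Sum.inr e)) ∨
          (∃ p : Fin G₂.k × Fin 3, (G₂.piece p.1).rank ≤ (p.2 : ℕ) ∧ y = eg (Sum.inl p)) ∨
            ∃ w, (w ∈ Done ∨ w ∈ bs.map Prod.fst) ∧ ∃ i, y = eg (Sum.inl (w, i))) ∧
        (∀ r, r ∈ (Roe.endState seg st).2.2 ↔ (∃ x, r = er (Sum.inr x)) ∨
          ∃ e, (Used e ∨ ∃ b ∈ bs, e ∈ b.2) ∧ r = er (Sum.inl e)) := by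
  classical
  intro bs
  induction bs with
  | nil =>
    intro Done Used st _ _ _ _ _ hK hE hU
    refine ⟨[], Roe.segValid_nil, ?_, ?_, ?_⟩
    · rw [Roe.endState_nil]; exact hK
    · rw [Roe.endState_nil]
      intro y
      rw [hE y]
      simp
    · rw [Roe.endState_nil]
      intro r
      rw [hU r]
      simp
  | cons b rest ih =>
    intro Done Used st hok hnd hnotDone hpw hUsed hK hE hU
    obtain ⟨v, own⟩ := b
    rw [blocksOK_cons] at hok
    obtain ⟨hblk, ⟨ls, hcheck, hperm⟩, hrest⟩ := hok
    rw [List.map_cons, List.nodup_cons] at hnd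
    obtain ⟨hvN, hnd'⟩ := hnd
    rw [List.pairwise_cons] at hpw
    obtain ⟨hdisj, hpw'⟩ := hpw
    have hvD : v ∉ Done := hnotDone (v, own) List.mem_cons_self
    -- the hypotheses of the piece block
    have hown : ∀ e ∈ own, (G₂.src e).1 = v ∨ (G₂.tgt e).1 = v := fun e he => (hblk e he).1
    have hfar : ∀ e ∈ own, ∀ i, eg (Sum.inl (G₂.other e v, i)) ∈ st.2.1 := fun e he i =>
      (hE _).mpr (Or.inr (Or.inr ⟨G₂.other e v, (hblk e he).2, i, rfl⟩))
    have hstab : ∀ e ∈ own, eg (Sum.inr e) ∈ st.2.1 := fun e _ => (hE _).mpr (Or.inl ⟨e, rfl⟩)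
    have hunused : ∀ i : Fin 3, (G₂.piece v).rank ≤ (i : ℕ) → G₂.gl eg v i ∈ st.2.1 := fun i hi =>
      (hE _).mpr (Or.inr (Or.inl ⟨(v, i), hi, rfl⟩))
    have hused : ∀ i : Fin 3, (i : ℕ) < (G₂.piece v).rank → G₂.gl eg v i ∉ st.2.1 := by
      intro i hi h
      rw [hE] at h
      rcases h with ⟨e, h⟩ | ⟨p, hp, h⟩ | ⟨w, hw, i', h⟩
      · simp [gl] at h
      · simp only [gl, EmbeddingLike.apply_eq_iff_eq, Sum.inl.injEq] at h
        rw [← h] at hp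
        exact absurd hi (not_lt.mpr hp)
      · simp only [gl, EmbeddingLike.apply_eq_iff_eq, Sum.inl.injEq, Prod.mk.injEq] at h
        exact hvD (h.1 ▸ hw)
    have hU₀ : ∀ e ∈ own, er (Sum.inl e) ∉ st.2.2 := by
      intro e he h
      rw [hU] at h
      rcases h with ⟨x, h⟩ | ⟨e', hue, h⟩
      · simp at h
      · have : e = e' := Sum.inl_injective (er.injective h)
        subst this
        exact hUsed (v, own) List.mem_cons_self e he hue
    have hports : ∀ s ∈ ls, ∃ e ∈ own, G₂.uport e v = s.port := by
      intro s hs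
      exact mem_uports.mp (hperm.mem_iff.mp (List.mem_map.mpr ⟨s, hs, rfl⟩))
    have hndp : (ls.map LStep.port).Nodup := hperm.nodup_iff.mpr (Finset.sort_nodup _ _)
    have hΦa : ∀ i, st.1 (FreeGroup.of (G₂.gl eg v i)) = FreeGroup.map (G₂.gl eg v) (linit (G₂.piece v) i) := by
      intro i
      rw [hK]
      unfold linit
      by_cases hi : (G₂.piece v).rank ≤ (i : ℕ)
      · rw [if_pos (hunused i hi), if_pos hi, map_one]
      · rw [if_neg (hused i (not_le.mp hi)), if_neg hi, FreeGroup.map.of]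
    have hΦb : ∀ y, (∀ i, y ≠ G₂.gl eg v i) → st.1 (FreeGroup.of y) = if y ∈ st.2.1 then 1 else FreeGroup.of y :=
      fun y _ => hK y
    have hEb : ∀ y, y ∈ st.2.1 ↔ y ∈ st.2.1 ∨ ∃ i ∈ lunused (G₂.piece v), y = G₂.gl eg v i := by
      intro y
      constructor
      · exact Or.inl
      · rintro (h | ⟨i, hi, rfl⟩)
        · exact h
        · unfold lunused at hi
          rw [List.mem_filter, decide_eq_true_eq] at hi
          exact hunused i hi.2
    have hlun : ∀ i : Fin 3, (G₂.piece v).rank ≤ (i : ℕ) → i ∈ lunused (G₂.piece v) := by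
      intro i hi
      unfold lunused
      rw [List.mem_filter, decide_eq_true_eq]
      exact ⟨List.mem_finRange i, hi⟩
    have hUb : ∀ r, r ∈ st.2.2 ↔ r ∈ st.2.2 ∨ ∃ e ∈ own, G₂.uport e v ∉ ls.map LStep.port ∧ r = er (Sum.inl e) := by
      intro r
      constructor
      · exact Or.inl
      · rintro (h | ⟨e, he, hne, rfl⟩)
        · exact h
        · exact absurd (hperm.mem_iff.mpr (mem_uports.mpr ⟨e, he, rfl⟩)) hne
    obtain ⟨seg₁, hseg₁, hK₁, hE₁, hU₁⟩ := block_seg hself hI eg er v own hown st.2.1 st.2.2 hfar hstab hused hU₀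
      ls (linit (G₂.piece v)) (lunused (G₂.piece v)) st hcheck hports hndp hΦa hΦb hEb hlun hUb
    -- the remaining blocks from the end state of the block of `v`
    have hnotDone' : ∀ b ∈ rest, b.1 ∉ insert v Done := by
      intro b hb h
      rw [Finset.mem_insert] at h
      rcases h with h | h
      · exact hvN (h ▸ List.mem_map.mpr ⟨b, hb, rfl⟩)
      · exact hnotDone b (List.mem_cons_of_mem _ hb) h
    have hUsed' : ∀ b ∈ rest, ∀ e ∈ b.2, ¬ (Used e ∨ e ∈ own) := by
      intro b hb e he h
      rcases h with h | h
      · exact hUsed b (List.mem_cons_of_mem _ hb) e he h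
      · exact Finset.disjoint_left.mp (hdisj b hb) h he
    have hE₁' : ∀ y, y ∈ (Roe.endState seg₁ st).2.1 ↔ (∃ e, y = eg (Sum.inr e)) ∨
        (∃ p : Fin G₂.k × Fin 3, (G₂.piece p.1).rank ≤ (p.2 : ℕ) ∧ y = eg (Sum.inl p)) ∨
          ∃ w ∈ insert v Done, ∃ i, y = eg (Sum.inl (w, i)) := by
      intro y
      rw [hE₁ y, hE y]
      constructor
      · rintro ((h | h | ⟨w, hw, i, h⟩) | ⟨i, h⟩)
        · exact Or.inl h
        · exact Or.inr (Or.inl h)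
        · exact Or.inr (Or.inr ⟨w, Finset.mem_insert_of_mem hw, i, h⟩)
        · exact Or.inr (Or.inr ⟨v, Finset.mem_insert_self v Done, i, h⟩)
      · rintro (h | h | ⟨w, hw, i, h⟩)
        · exact Or.inl (Or.inl h)
        · exact Or.inl (Or.inr (Or.inl h))
        · rcases Finset.mem_insert.mp hw with rfl | hw
          · exact Or.inr ⟨i, h⟩
          · exact Or.inl (Or.inr (Or.inr ⟨w, hw, i, h⟩))
    have hU₁' : ∀ r, r ∈ (Roe.endState seg₁ st).2.2 ↔ (∃ x, r = er (Sum.inr x)) ∨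
        ∃ e, (Used e ∨ e ∈ own) ∧ r = er (Sum.inl e) := by
      intro r
      rw [hU₁ r, hU r]
      constructor
      · rintro ((h | ⟨e, hue, h⟩) | ⟨e, he, h⟩)
        · exact Or.inl h
        · exact Or.inr ⟨e, Or.inl hue, h⟩
        · exact Or.inr ⟨e, Or.inr he, h⟩
      · rintro (h | ⟨e, hue | he, h⟩)
        · exact Or.inl (Or.inl h)
        · exact Or.inl (Or.inr ⟨e, hue, h⟩)
        · exact Or.inr ⟨e, he, h⟩
    obtain ⟨seg₂, hseg₂, hK₂, hE₂, hU₂⟩ := ih (insert v Done) (fun e => Used e ∨ e ∈ own) (Roe.endState seg₁ st)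
      hrest hnd' hnotDone' hpw' hUsed' hK₁ hE₁' hU₁'
    refine ⟨seg₁ ++ seg₂, Roe.seg_append _ _ _ hseg₁ hseg₂, ?_, ?_, ?_⟩
    · rw [Roe.endState_append]; exact hK₂
    · rw [Roe.endState_append]
      intro y
      rw [hE₂ y]
      simp only [Finset.mem_insert, List.map_cons, List.mem_cons]
      constructor
      · rintro (h | h | ⟨w, hw, i, h⟩)
        · exact Or.inl h
        · exact Or.inr (Or.inl h)
        · refine Or.inr (Or.inr ⟨w, ?_, i, h⟩); tauto
      · rintro (h | h | ⟨w, hw, i, h⟩)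
        · exact Or.inl h
        · exact Or.inr (Or.inl h)
        · refine Or.inr (Or.inr ⟨w, ?_, i, h⟩); tauto
    · rw [Roe.endState_append]
      intro r
      rw [hU₂ r]
      simp only [List.mem_cons]
      constructor
      · rintro (h | ⟨e, he, h⟩)
        · exact Or.inl h
        · refine Or.inr ⟨e, ?_, h⟩
          rcases he with (he | he) | ⟨b, hb, he⟩
          · exact Or.inl he
          · exact Or.inr ⟨(v, own), Or.inl rfl, he⟩
          · exact Or.inr ⟨b, Or.inr hb, he⟩
      · rintro (h | ⟨e, he, h⟩)
        · exact Or.inl h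
        · refine Or.inr ⟨e, ?_, h⟩
          rcases he with he | ⟨b, rfl | hb, he⟩
          · exact Or.inl (Or.inl he)
          · exact Or.inl (Or.inr he)
          · exact Or.inr ⟨b, hb, he⟩

end ShadowGraph

/-! ## §13 The registered stub -/

/-- **`stub_gradeTwoDichotomy` — THE GRADE-TWO DICHOTOMY IN CERTIFICATE FORM, PROVED.**  For an admissible encoding
graph `G₂` whose presentation `P(G₂)` presents the trivial group: (1) `H₁ = 0` makes the exponent table unimodular
(`um_full₂`), so no gluing is a non-tree gluing (`tree_eq_true_of_presentsTrivialGroup`: a non-tree stable letter would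
survive in the abelianisation) and the block `(gluings) × (used letters)` is unimodular (`um_top₂`); (2) peeling the
spanning tree leaf by leaf (`peel_rec`) assigns to every piece a set of owned gluings whose local exponent minor is
unimodular, and the LOCAL TABLE (`localTable`, 106 decidable certificates `lcheck … = true`, one per unimodular
(piece, port set)) converts local unimodularity into a local one-occurrence elimination order (`localCert_of_um`);
(3) the one-letter relators (tree stable letters, unused letters) are eliminated first (`Roe.oneLetter_seg`), then the
pieces in peeling order, each by its local certificate transported to the global letters (`block_seg`, `blocks_seg`):
after the far ends and the stable letter of an owned gluing are killed, its relator is the image of the local port word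
(`lift_rel_u`), so the local conjugacy `c · w^{±1} · c⁻¹ = x · W` becomes the global step condition. -/
theorem stub_gradeTwoDichotomy : GradeTwoDichotomy := by
  classical
  intro G₂ n eg er hA hAC
  obtain ⟨hV, hI, hT⟩ := hA
  have hall : ∀ e, G₂.tree e = true := G₂.tree_eq_true_of_presentsTrivialGroup eg er hAC
  have hself : ∀ e, (G₂.src e).1 ≠ (G₂.tgt e).1 := fun e => hT.1 e (hall e)
  -- (2) the structural peeling certificate of the whole graph
  have hk : (Finset.univ : Finset (Fin G₂.k)).card = (G₂.k - 1) + 1 := by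
    have := hT.2.2
    rw [Finset.card_univ, Fintype.card_fin]
    omega
  obtain ⟨bs, hnd, hfst, hpw, hrows, hok⟩ := G₂.peel_rec hV hI hT hall (G₂.k - 1) Finset.univ ∅ hk
    (Finset.disjoint_empty_right _) (G₂.induce_univ_connected₂ hT) (G₂.um_top₂ hall eg er hAC)
  -- (3a) the one-letter relators
  have hlt : Function.Injective fun x : {e : Fin G₂.m // G₂.tree e = true} ⊕
      {p : Fin G₂.k × Fin 3 // (G₂.piece p.1).rank ≤ (p.2 : ℕ)} => eg (G₂.ownLetter (Sum.inr x)) :=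
    fun x y h => ShadowGraph.ownLetter_inr_injective (eg.injective h)
  have hrl : Function.Injective fun x : {e : Fin G₂.m // G₂.tree e = true} ⊕
      {p : Fin G₂.k × Fin 3 // (G₂.piece p.1).rank ≤ (p.2 : ℕ)} => er (Sum.inr x) :=
    fun x y h => Sum.inr_injective (er.injective h)
  obtain ⟨hseg₀, hK₀, hE₀, hU₀⟩ := Roe.oneLetter_seg (P := G₂.presentation eg er)
    (fun x => eg (G₂.ownLetter (Sum.inr x))) (fun x => er (Sum.inr x)) hlt hrl
    (fun x => ShadowGraph.presentation_inr eg er x) (Finset.univ.toList) (MonoidHom.id _, ∅, ∅)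
    (Finset.nodup_toList _) Roe.kills_id (fun _ _ => by simp) (fun _ _ => by simp)
  -- (3b) the pieces in peeling order
  have hE₁ : ∀ y, y ∈ (Roe.endState (Finset.univ.toList.map fun x : {e : Fin G₂.m // G₂.tree e = true} ⊕
      {p : Fin G₂.k × Fin 3 // (G₂.piece p.1).rank ≤ (p.2 : ℕ)} =>
        (⟨er (Sum.inr x), eg (G₂.ownLetter (Sum.inr x)), 1, true⟩ : Roe.Step n)) (MonoidHom.id _, ∅, ∅)).2.1 ↔
      (∃ e, y = eg (Sum.inr e)) ∨ (∃ p : Fin G₂.k × Fin 3, (G₂.piece p.1).rank ≤ (p.2 : ℕ) ∧ y = eg (Sum.inl p)) ∨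
        ∃ w ∈ (∅ : Finset (Fin G₂.k)), ∃ i, y = eg (Sum.inl (w, i)) := by
    intro y
    rw [hE₀]
    simp only [Finset.empty_union, List.mem_toFinset, List.mem_map, Finset.mem_toList, Finset.mem_univ, true_and,
      Finset.notMem_empty, false_and, exists_false, or_false]
    constructor
    · rintro ⟨x, rfl⟩
      rcases x with ⟨e, he⟩ | ⟨p, hp⟩
      · exact Or.inl ⟨e, rfl⟩
      · exact Or.inr ⟨p, hp, rfl⟩
    · rintro (⟨e, rfl⟩ | ⟨p, hp, rfl⟩)
      · exact ⟨Sum.inl ⟨e, hall e⟩, rfl⟩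
      · exact ⟨Sum.inr ⟨p, hp⟩, rfl⟩
  have hU₁ : ∀ r, r ∈ (Roe.endState (Finset.univ.toList.map fun x : {e : Fin G₂.m // G₂.tree e = true} ⊕
      {p : Fin G₂.k × Fin 3 // (G₂.piece p.1).rank ≤ (p.2 : ℕ)} =>
        (⟨er (Sum.inr x), eg (G₂.ownLetter (Sum.inr x)), 1, true⟩ : Roe.Step n)) (MonoidHom.id _, ∅, ∅)).2.2 ↔
      (∃ x, r = er (Sum.inr x)) ∨ ∃ e, False ∧ r = er (Sum.inl e) := by
    intro r
    rw [hU₀]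
    simp only [Finset.empty_union, List.mem_toFinset, List.mem_map, Finset.mem_toList, Finset.mem_univ, true_and,
      false_and, exists_false, or_false]
    exact ⟨fun ⟨x, h⟩ => ⟨x, h.symm⟩, fun ⟨x, h⟩ => ⟨x, h.symm⟩⟩
  obtain ⟨seg₁, hseg₁, -, hE₂, hU₂⟩ := ShadowGraph.blocks_seg hself hI eg er bs ∅ (fun _ => False) _ hok hnd
    (fun _ _ => Finset.notMem_empty _) hpw (fun _ _ _ _ h => h) hK₀ hE₁ hU₁
  refine Roe.hasCertificate_of_seg _ (Roe.seg_append _ _ _ hseg₀ hseg₁) ?_ ?_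
  · rw [Roe.endState_append]
    refine Finset.eq_univ_of_forall fun y => (hE₂ y).mpr ?_
    obtain ⟨g, rfl⟩ := eg.surjective y
    rcases g with ⟨w, i⟩ | e
    · exact Or.inr (Or.inr ⟨w, Or.inr ((hfst w).mpr (Finset.mem_univ w)), i, rfl⟩)
    · exact Or.inl ⟨e, rfl⟩
  · rw [Roe.endState_append]
    refine Finset.eq_univ_of_forall fun r => (hU₂ r).mpr ?_
    obtain ⟨ρ, rfl⟩ := er.surjective r
    rcases ρ with e | x
    · refine Or.inr ⟨e, Or.inr ((hrows e).mp ?_), rfl⟩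
      rw [ShadowGraph.rows_univ₂]
      exact Finset.mem_univ e
    · exact Or.inl ⟨x, rfl⟩

end Summit.SmoothPoincare4.SmoothPoincare4.Theorems.RootDecompAEDoublesShadowTwoStubGradeTwoDichotomy
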